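/-
Copyright: harness cell b2b-lgcu-borel (gen 6).  Honest framing: the VALUE here is a THEOREM /
a DECIDABLE VERDICT / a CERTIFICATE — NOT summit progress.
-/
import Summits.MatrixMultiplication.MatrixMultiplication.Theorems.SubgroupIdentityDesigns.Negative.BorelVolumeBound
import Summits.MatrixMultiplication.MatrixMultiplication.Theorems.SubgroupIdentityDesigns.Negative.SubgroupLineCount

/-!
# A Weil-type volume ceiling for ALL Borel TPP triples in `GL₂(𝔽_p)`

`BorelVolumeBound.borel_tpp_volume_le` gives `|H₁||H₂||H₃| ≤ (p-1)⁴` for upper-triangular TPP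
triples; here this is sharpened to `|H₁||H₂||H₃| ≤ (p-1)³(2 + √p)`.  A unipotent-free
upper-triangular subgroup is abelian with normal form `h₀₁ = c_H (h₁₁ - h₀₀)`
(`exists_cocycle_const`); on the kernel `K` of the diagonal map `H₁ × H₂ × H₃ → 𝔽ₚˣ × 𝔽ₚˣ`
(`|H₁||H₂||H₃| ≤ (p-1)²|K|`) the TPP says that the line `(c₂-c₁)α + (c₃-c₂) = (c₃-c₁)β` meets
`Γ = {(z₂/x₂, x₃/z₃)} ≅ K` only at `(1,1)`, so `SubgroupLineCount.card_le_of_line_trivial`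
(orthogonality + Jacobi sums) gives `|K| ≤ (p-1)(2 + √p)`; degenerate constants give
`|K| ≤ p - 1`, and a unipotent in some `Hᵢ` gives `≤ p(p-1)²` (`volume_le_of_unipotent`).
Consequence: no Borel instance of the template certifies an exponent below `4 - o(1)`
(`d = V/(p-1)³ ≤ 2 + √p`).  VALUE = a theorem delimiting the search space, NOT summit progress.
-/

open scoped BigOperators Classical
open Summit.MatrixMultiplication.MatrixMultiplication.Theorems.LieRankDesigns.Negative (GLm Mat)

namespace Summit.MatrixMultiplication.MatrixMultiplication.Theorems.SubgroupIdentityDesigns.Negative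

variable {p : ℕ} [hp : Fact p.Prime]

open Literature.Barriers.MatrixMultiplication (SubgroupTPP)
open ShiftedSubgroup (card_le_of_line_trivial)

section ToralCeiling

/-- The `(0,1)` entry of a product in `GL₂`. -/
theorem mul_apply01 (a b : GLm p 2) :
    ((a * b : GLm p 2) : Mat p 2) 0 1
      = (a : Mat p 2) 0 0 * (b : Mat p 2) 0 1 + (a : Mat p 2) 0 1 * (b : Mat p 2) 1 1 := by
  rw [Units.val_mul, Matrix.mul_apply, Fin.sum_univ_two]

/-- `(g^{n+1})₀₁ = (n+1)·g₁₁ⁿ·g₀₁` for an upper-triangular `g` with scalar diagonal. -/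
theorem upper_pow_apply01_of_scalar {g : GLm p 2} (hg : (g : Mat p 2) 1 0 = 0)
    (hd : (g : Mat p 2) 0 0 = (g : Mat p 2) 1 1) (n : ℕ) :
    ((g ^ (n + 1) : GLm p 2) : Mat p 2) 0 1
      = ((n + 1 : ℕ) : ZMod p) * ((g : Mat p 2) 1 1) ^ n * (g : Mat p 2) 0 1 := by
  induction n with
  | zero => simp
  | succ n ih =>
    rw [pow_succ, mul_apply01, ih, upper_pow_apply00 hg, hd]
    push_cast
    ring

/-- The diagonal of an upper-triangular subgroup as a homomorphism to `𝔽ₚˣ × 𝔽ₚˣ`. -/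
noncomputable def diagHom {H : Subgroup (GLm p 2)} (hH : ∀ h ∈ H, (h : Mat p 2) 1 0 = 0) :
    H →* (ZMod p)ˣ × (ZMod p)ˣ where
  toFun h := (Units.mk0 _ (mem_diag_ne_zero hH h).1, Units.mk0 _ (mem_diag_ne_zero hH h).2)
  map_one' := Prod.ext (Units.ext (by simp)) (Units.ext (by simp))
  map_mul' a b := Prod.ext
    (Units.ext (by simp [upper_mul_apply00 (hH _ b.2)]))
    (Units.ext (by simp [upper_mul_apply11 (hH _ a.2)]))

/-- First coordinate of `diagHom`. -/
theorem diagHom_fst {H : Subgroup (GLm p 2)} (hH : ∀ h ∈ H, (h : Mat p 2) 1 0 = 0) (h : H) :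
    ((diagHom hH h).1 : ZMod p) = ((h : GLm p 2) : Mat p 2) 0 0 := rfl

/-- Second coordinate of `diagHom`. -/
theorem diagHom_snd {H : Subgroup (GLm p 2)} (hH : ∀ h ∈ H, (h : Mat p 2) 1 0 = 0) (h : H) :
    ((diagHom hH h).2 : ZMod p) = ((h : GLm p 2) : Mat p 2) 1 1 := rfl

/-- Without unipotents the diagonal map is injective. -/
theorem diagHom_injective {H : Subgroup (GLm p 2)} (hH : ∀ h ∈ H, (h : Mat p 2) 1 0 = 0)
    (hA : ∀ h ∈ H, (h : Mat p 2) 0 0 = 1 → (h : Mat p 2) 1 1 = 1 → h = 1) :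
    Function.Injective (diagHom hH) := by
  refine (injective_iff_map_eq_one _).mpr fun h h1 => ?_
  have e00 : ((h : GLm p 2) : Mat p 2) 0 0 = 1 := by
    rw [← diagHom_fst hH h, h1, Prod.fst_one, Units.val_one]
  have e11 : ((h : GLm p 2) : Mat p 2) 1 1 = 1 := by
    rw [← diagHom_snd hH h, h1, Prod.snd_one, Units.val_one]
  exact Subtype.ext (by rw [OneMemClass.coe_one]; exact hA _ h.2 e00 e11)

/-- A unipotent-free upper-triangular subgroup is abelian. -/
theorem mul_comm_of_noUnipotent {H : Subgroup (GLm p 2)} (hH : ∀ h ∈ H, (h : Mat p 2) 1 0 = 0)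
    (hA : ∀ h ∈ H, (h : Mat p 2) 0 0 = 1 → (h : Mat p 2) 1 1 = 1 → h = 1) {a b : GLm p 2}
    (ha : a ∈ H) (hb : b ∈ H) : a * b = b * a := by
  have key : (⟨a, ha⟩ * ⟨b, hb⟩ : H) = ⟨b, hb⟩ * ⟨a, ha⟩ :=
    diagHom_injective hH hA (by rw [map_mul, map_mul, mul_comm])
  exact congrArg Subtype.val key

/-- **Normal form.** A unipotent-free upper-triangular subgroup has a constant `c` with
`h₀₁ = c (h₁₁ - h₀₀)` for all its elements (i.e. it lies in the torus `u_c D u_c⁻¹`). -/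
theorem exists_cocycle_const {H : Subgroup (GLm p 2)} (hH : ∀ h ∈ H, (h : Mat p 2) 1 0 = 0)
    (hA : ∀ h ∈ H, (h : Mat p 2) 0 0 = 1 → (h : Mat p 2) 1 1 = 1 → h = 1) :
    ∃ c : ZMod p, ∀ h ∈ H, (h : Mat p 2) 0 1 = c * ((h : Mat p 2) 1 1 - (h : Mat p 2) 0 0) := by
  by_cases hns : ∃ h₀ ∈ H, (h₀ : Mat p 2) 0 0 ≠ (h₀ : Mat p 2) 1 1
  · obtain ⟨h₀, hh₀, hne⟩ := hns
    have hd : (h₀ : Mat p 2) 1 1 - (h₀ : Mat p 2) 0 0 ≠ 0 := sub_ne_zero.mpr (Ne.symm hne)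
    refine ⟨(h₀ : Mat p 2) 0 1 / ((h₀ : Mat p 2) 1 1 - (h₀ : Mat p 2) 0 0), fun h hh => ?_⟩
    have e : (h : Mat p 2) 0 0 * (h₀ : Mat p 2) 0 1 + (h : Mat p 2) 0 1 * (h₀ : Mat p 2) 1 1
        = (h₀ : Mat p 2) 0 0 * (h : Mat p 2) 0 1 + (h₀ : Mat p 2) 0 1 * (h : Mat p 2) 1 1 := by
      rw [← mul_apply01, ← mul_apply01, mul_comm_of_noUnipotent hH hA hh hh₀]
    field_simp
    linear_combination e
  · push Not at hns
    refine ⟨0, fun h hh => ?_⟩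
    rw [zero_mul]
    have hu := hH h hh
    obtain ⟨hx, hz⟩ := upper_diag_ne_zero h hu
    obtain ⟨m, hm⟩ : ∃ m, p - 1 = m + 1 := ⟨p - 2, by have := hp.out.two_le; omega⟩
    have hpow : h ^ (p - 1) = 1 := hA _ (H.pow_mem hh _)
      (by rw [upper_pow_apply00 hu, ZMod.pow_card_sub_one_eq_one hx])
      (by rw [upper_pow_apply11 hu, ZMod.pow_card_sub_one_eq_one hz])
    have e : ((h ^ (p - 1) : GLm p 2) : Mat p 2) 0 1 = 0 := by
      rw [hpow, Units.val_one, Matrix.one_apply_ne (by decide)]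
    rw [hm, upper_pow_apply01_of_scalar hu (hns h hh) m] at e
    have hm1 : ((m + 1 : ℕ) : ZMod p) ≠ 0 := by
      rw [← hm, Nat.cast_sub hp.out.one_le, Nat.cast_one, ZMod.natCast_self, zero_sub]
      exact neg_ne_zero.mpr one_ne_zero
    have hm1' : (m : ZMod p) + 1 ≠ 0 := by exact_mod_cast hm1
    simpa [hm1', hz] using e

/-- The product of the three diagonal maps `H₁ × H₂ × H₃ → 𝔽ₚˣ × 𝔽ₚˣ`. -/
noncomputable def tripleDiag {H₁ H₂ H₃ : Subgroup (GLm p 2)}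
    (hH₁ : ∀ h ∈ H₁, (h : Mat p 2) 1 0 = 0) (hH₂ : ∀ h ∈ H₂, (h : Mat p 2) 1 0 = 0)
    (hH₃ : ∀ h ∈ H₃, (h : Mat p 2) 1 0 = 0) : H₁ × H₂ × H₃ →* (ZMod p)ˣ × (ZMod p)ˣ :=
  (diagHom hH₁).comp (MonoidHom.fst H₁ (H₂ × H₃)) *
    ((diagHom hH₂).comp ((MonoidHom.fst H₂ H₃).comp (MonoidHom.snd H₁ (H₂ × H₃))) *
      (diagHom hH₃).comp ((MonoidHom.snd H₂ H₃).comp (MonoidHom.snd H₁ (H₂ × H₃))))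

/-- On the kernel of `tripleDiag` the diagonal entries multiply to `1`. -/
theorem ker_entries {H₁ H₂ H₃ : Subgroup (GLm p 2)}
    (hH₁ : ∀ h ∈ H₁, (h : Mat p 2) 1 0 = 0) (hH₂ : ∀ h ∈ H₂, (h : Mat p 2) 1 0 = 0)
    (hH₃ : ∀ h ∈ H₃, (h : Mat p 2) 1 0 = 0) {e : H₁ × H₂ × H₃}
    (he : e ∈ (tripleDiag hH₁ hH₂ hH₃).ker) :
    ((e.1 : GLm p 2) : Mat p 2) 0 0 * ((e.2.1 : GLm p 2) : Mat p 2) 0 0 *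
        ((e.2.2 : GLm p 2) : Mat p 2) 0 0 = 1 ∧
      ((e.1 : GLm p 2) : Mat p 2) 1 1 * ((e.2.1 : GLm p 2) : Mat p 2) 1 1 *
        ((e.2.2 : GLm p 2) : Mat p 2) 1 1 = 1 := by
  rw [MonoidHom.mem_ker] at he
  have hfst : ((tripleDiag hH₁ hH₂ hH₃ e).1 : ZMod p)
      = ((e.1 : GLm p 2) : Mat p 2) 0 0 * ((e.2.1 : GLm p 2) : Mat p 2) 0 0 *
        ((e.2.2 : GLm p 2) : Mat p 2) 0 0 := by
    show (((diagHom hH₁ e.1) * ((diagHom hH₂ e.2.1) * (diagHom hH₃ e.2.2))).1 : ZMod p) = _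
    rw [Prod.fst_mul, Prod.fst_mul, Units.val_mul, Units.val_mul, diagHom_fst, diagHom_fst,
      diagHom_fst, mul_assoc]
  have hsnd : ((tripleDiag hH₁ hH₂ hH₃ e).2 : ZMod p)
      = ((e.1 : GLm p 2) : Mat p 2) 1 1 * ((e.2.1 : GLm p 2) : Mat p 2) 1 1 *
        ((e.2.2 : GLm p 2) : Mat p 2) 1 1 := by
    show (((diagHom hH₁ e.1) * ((diagHom hH₂ e.2.1) * (diagHom hH₃ e.2.2))).2 : ZMod p) = _
    rw [Prod.snd_mul, Prod.snd_mul, Units.val_mul, Units.val_mul, diagHom_snd, diagHom_snd,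
      diagHom_snd, mul_assoc]
  refine ⟨?_, ?_⟩
  · rw [← hfst, he, Prod.fst_one, Units.val_one]
  · rw [← hsnd, he, Prod.snd_one, Units.val_one]

/-- The ratio map `e ↦ (z₂/x₂, x₃/z₃)` on `H₁ × H₂ × H₃`. -/
noncomputable def ratioHom {H₁ H₂ H₃ : Subgroup (GLm p 2)}
    (hH₂ : ∀ h ∈ H₂, (h : Mat p 2) 1 0 = 0) (hH₃ : ∀ h ∈ H₃, (h : Mat p 2) 1 0 = 0) :
    H₁ × H₂ × H₃ →* (ZMod p)ˣ × (ZMod p)ˣ where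
  toFun e :=
    (Units.mk0 (((e.2.1 : GLm p 2) : Mat p 2) 1 1 / ((e.2.1 : GLm p 2) : Mat p 2) 0 0)
        (div_ne_zero (mem_diag_ne_zero hH₂ e.2.1).2 (mem_diag_ne_zero hH₂ e.2.1).1),
      Units.mk0 (((e.2.2 : GLm p 2) : Mat p 2) 0 0 / ((e.2.2 : GLm p 2) : Mat p 2) 1 1)
        (div_ne_zero (mem_diag_ne_zero hH₃ e.2.2).1 (mem_diag_ne_zero hH₃ e.2.2).2))
  map_one' := Prod.ext (Units.ext (by simp)) (Units.ext (by simp))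
  map_mul' a b := by
    refine Prod.ext (Units.ext ?_) (Units.ext ?_)
    · simp only [Prod.snd_mul, Prod.fst_mul, Subgroup.coe_mul, Units.val_mk0, Units.val_mul,
        upper_mul_apply00 (hH₂ _ b.2.1.2), upper_mul_apply11 (hH₂ _ a.2.1.2)]
      rw [div_mul_div_comm]
    · simp only [Prod.snd_mul, Subgroup.coe_mul, Units.val_mk0, Units.val_mul,
        upper_mul_apply00 (hH₃ _ b.2.2.2), upper_mul_apply11 (hH₃ _ a.2.2.2)]
      rw [div_mul_div_comm]

/-- The entries identity behind the line condition: with `x₁ = (x₂x₃)⁻¹`, `z₁ = (z₂z₃)⁻¹` and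
`yᵢ = cᵢ(zᵢ - xᵢ)`, the `(0,1)` entry of `h₁h₂h₃` is a multiple of
`(c₂-c₁)·(z₂/x₂) + (c₃-c₂) - (c₃-c₁)·(x₃/z₃)`. -/
theorem entry01_identity (c₁ c₂ c₃ x₁ x₂ x₃ z₁ z₂ z₃ : ZMod p) (hx₂ : x₂ ≠ 0) (hx₃ : x₃ ≠ 0)
    (hz₂ : z₂ ≠ 0) (hz₃ : z₃ ≠ 0) (hx : x₁ * x₂ * x₃ = 1) (hz : z₁ * z₂ * z₃ = 1) :
    (x₁ * x₂ * (c₃ * (z₃ - x₃)) + (x₁ * (c₂ * (z₂ - x₂)) + c₁ * (z₁ - x₁) * z₂) * z₃)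
        * (x₂ * x₃)
      = ((c₂ - c₁) * (z₂ / x₂) + (c₃ - c₂) - (c₃ - c₁) * (x₃ / z₃)) * (x₂ * z₃) := by
  have hx₁ : x₁ = (x₂ * x₃)⁻¹ := eq_inv_of_mul_eq_one_left (by rw [← mul_assoc]; exact hx)
  have hz₁ : z₁ = (z₂ * z₃)⁻¹ := eq_inv_of_mul_eq_one_left (by rw [← mul_assoc]; exact hz)
  rw [hx₁, hz₁]
  field_simp
  ring

/-- **Line condition ⇒ trivial.** For a TPP triple of unipotent-free upper-triangular subgroups
with normal-form constants `cᵢ`, an element `e = (h₁,h₂,h₃)` of the diagonal kernel with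
`(c₂-c₁)·(z₂/x₂) + (c₃-c₂) = (c₃-c₁)·(x₃/z₃)` satisfies `h₁h₂h₃ = 1`, hence `e = 1`. -/
theorem ker_eq_one_of_cond {H₁ H₂ H₃ : Subgroup (GLm p 2)}
    (hH₁ : ∀ h ∈ H₁, (h : Mat p 2) 1 0 = 0) (hH₂ : ∀ h ∈ H₂, (h : Mat p 2) 1 0 = 0)
    (hH₃ : ∀ h ∈ H₃, (h : Mat p 2) 1 0 = 0) (htpp : SubgroupTPP H₁ H₂ H₃) {c₁ c₂ c₃ : ZMod p}
    (hc₁ : ∀ h ∈ H₁, (h : Mat p 2) 0 1 = c₁ * ((h : Mat p 2) 1 1 - (h : Mat p 2) 0 0))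
    (hc₂ : ∀ h ∈ H₂, (h : Mat p 2) 0 1 = c₂ * ((h : Mat p 2) 1 1 - (h : Mat p 2) 0 0))
    (hc₃ : ∀ h ∈ H₃, (h : Mat p 2) 0 1 = c₃ * ((h : Mat p 2) 1 1 - (h : Mat p 2) 0 0))
    {e : H₁ × H₂ × H₃} (he : e ∈ (tripleDiag hH₁ hH₂ hH₃).ker)
    (hcond : (c₂ - c₁) * (((e.2.1 : GLm p 2) : Mat p 2) 1 1 / ((e.2.1 : GLm p 2) : Mat p 2) 0 0)
      + (c₃ - c₂)
      = (c₃ - c₁) * (((e.2.2 : GLm p 2) : Mat p 2) 0 0 / ((e.2.2 : GLm p 2) : Mat p 2) 1 1)) :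
    e = 1 := by
  obtain ⟨hx, hz⟩ := ker_entries hH₁ hH₂ hH₃ he
  have u₁ := hH₁ _ e.1.2
  have u₂ := hH₂ _ e.2.1.2
  have u₃ := hH₃ _ e.2.2.2
  obtain ⟨hx₂, hz₂⟩ := mem_diag_ne_zero hH₂ e.2.1
  obtain ⟨hx₃, hz₃⟩ := mem_diag_ne_zero hH₃ e.2.2
  set w : GLm p 2 := (e.1 : GLm p 2) * (e.2.1 : GLm p 2) * (e.2.2 : GLm p 2) with hw_def
  have hw10 : (w : Mat p 2) 1 0 = 0 := upper_mul (upper_mul u₁ u₂) u₃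
  have hw00 : (w : Mat p 2) 0 0 = 1 := by rw [hw_def, upper_mul_apply00 u₃, upper_mul_apply00 u₂, hx]
  have hw11 : (w : Mat p 2) 1 1 = 1 := by
    rw [hw_def, upper_mul_apply11 (upper_mul u₁ u₂), upper_mul_apply11 u₁, hz]
  have hw01 : (w : Mat p 2) 0 1 = 0 := by
    have e01 : (w : Mat p 2) 0 1
        = ((e.1 : GLm p 2) : Mat p 2) 0 0 * ((e.2.1 : GLm p 2) : Mat p 2) 0 0 *
            (c₃ * (((e.2.2 : GLm p 2) : Mat p 2) 1 1 - ((e.2.2 : GLm p 2) : Mat p 2) 0 0)) +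
          (((e.1 : GLm p 2) : Mat p 2) 0 0 *
              (c₂ * (((e.2.1 : GLm p 2) : Mat p 2) 1 1 - ((e.2.1 : GLm p 2) : Mat p 2) 0 0)) +
            c₁ * (((e.1 : GLm p 2) : Mat p 2) 1 1 - ((e.1 : GLm p 2) : Mat p 2) 0 0) *
              ((e.2.1 : GLm p 2) : Mat p 2) 1 1) * ((e.2.2 : GLm p 2) : Mat p 2) 1 1 := by
      rw [hw_def, mul_apply01, mul_apply01, upper_mul_apply00 u₂,
        hc₁ _ e.1.2, hc₂ _ e.2.1.2, hc₃ _ e.2.2.2]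
    have key := entry01_identity c₁ c₂ c₃ _ _ _ _ _ _ hx₂ hx₃ hz₂ hz₃ hx hz
    rw [← e01, hcond, sub_self, zero_mul] at key
    rcases mul_eq_zero.mp key with h0 | h0
    · exact h0
    · exact absurd h0 (mul_ne_zero hx₂ hx₃)
  have hw1 : w = 1 := eq_one_of_entries w hw10 hw00 hw01 hw11
  obtain ⟨h1, h2, h3⟩ := htpp _ e.1.2 _ e.2.1.2 _ e.2.2.2 (by rw [← hw_def]; exact hw1)
  exact Prod.ext (Subtype.ext (by simpa using h1))
    (Prod.ext (Subtype.ext (by simpa using h2)) (Subtype.ext (by simpa using h3)))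

/-- A hom from the kernel to `𝔽ₚˣ` with trivial kernel bounds `|K| ≤ p - 1`. -/
theorem card_le_of_hom_trivial_ker {G : Type*} [Group G] (K : Subgroup G) (f : K →* (ZMod p)ˣ)
    (hf : ∀ e : K, f e = 1 → e = 1) : Nat.card K ≤ p - 1 := by
  rw [← natCard_units (p := p)]
  exact Nat.card_le_card_of_injective f ((injective_iff_map_eq_one f).mpr hf)

/-- **Kernel bound.** For a TPP triple of unipotent-free upper-triangular subgroups, the
diagonal kernel `K` has `|K| ≤ (p-1)(2 + √p)`. -/
theorem card_ker_le {H₁ H₂ H₃ : Subgroup (GLm p 2)}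
    (hH₁ : ∀ h ∈ H₁, (h : Mat p 2) 1 0 = 0) (hH₂ : ∀ h ∈ H₂, (h : Mat p 2) 1 0 = 0)
    (hH₃ : ∀ h ∈ H₃, (h : Mat p 2) 1 0 = 0)
    (hA₁ : ∀ h ∈ H₁, (h : Mat p 2) 0 0 = 1 → (h : Mat p 2) 1 1 = 1 → h = 1)
    (hA₂ : ∀ h ∈ H₂, (h : Mat p 2) 0 0 = 1 → (h : Mat p 2) 1 1 = 1 → h = 1)
    (hA₃ : ∀ h ∈ H₃, (h : Mat p 2) 0 0 = 1 → (h : Mat p 2) 1 1 = 1 → h = 1)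
    (htpp : SubgroupTPP H₁ H₂ H₃) :
    (Nat.card (tripleDiag hH₁ hH₂ hH₃).ker : ℝ) ≤ ((p : ℝ) - 1) * (2 + Real.sqrt p) := by
  obtain ⟨c₁, hc₁⟩ := exists_cocycle_const hH₁ hA₁
  obtain ⟨c₂, hc₂⟩ := exists_cocycle_const hH₂ hA₂
  obtain ⟨c₃, hc₃⟩ := exists_cocycle_const hH₃ hA₃
  set K := (tripleDiag hH₁ hH₂ hH₃).ker with hK
  have viol : ∀ e : K,
      (c₂ - c₁) * ((((e : H₁ × H₂ × H₃).2.1 : GLm p 2) : Mat p 2) 1 1 /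
          (((e : H₁ × H₂ × H₃).2.1 : GLm p 2) : Mat p 2) 0 0) + (c₃ - c₂)
        = (c₃ - c₁) * ((((e : H₁ × H₂ × H₃).2.2 : GLm p 2) : Mat p 2) 0 0 /
          (((e : H₁ × H₂ × H₃).2.2 : GLm p 2) : Mat p 2) 1 1) → e = 1 :=
    fun e hcond => Subtype.ext (ker_eq_one_of_cond hH₁ hH₂ hH₃ htpp hc₁ hc₂ hc₃ e.2 hcond)
  -- the ratio map restricted to `K`
  set Λ : K →* (ZMod p)ˣ × (ZMod p)ˣ := (ratioHom (H₁ := H₁) hH₂ hH₃).comp K.subtype with hΛ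
  have hΛ1 : ∀ e : K, ((Λ e).1 : ZMod p)
      = (((e : H₁ × H₂ × H₃).2.1 : GLm p 2) : Mat p 2) 1 1 /
          (((e : H₁ × H₂ × H₃).2.1 : GLm p 2) : Mat p 2) 0 0 := fun e => rfl
  have hΛ2 : ∀ e : K, ((Λ e).2 : ZMod p)
      = (((e : H₁ × H₂ × H₃).2.2 : GLm p 2) : Mat p 2) 0 0 /
          (((e : H₁ × H₂ × H₃).2.2 : GLm p 2) : Mat p 2) 1 1 := fun e => rfl
  have hp1 : (0 : ℝ) ≤ (p : ℝ) - 1 := sub_nonneg.mpr (by exact_mod_cast hp.out.one_lt.le)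
  have hsmall : Nat.card K ≤ p - 1 → (Nat.card K : ℝ) ≤ ((p : ℝ) - 1) * (2 + Real.sqrt p) := by
    intro h
    have h' : (Nat.card K : ℝ) ≤ ((p - 1 : ℕ) : ℝ) := by exact_mod_cast h
    rw [Nat.cast_sub hp.out.one_le, Nat.cast_one] at h'
    nlinarith [Real.sqrt_nonneg (p : ℝ)]
  -- degenerate constants: a one-variable condition already forces triviality
  by_cases h12 : c₁ = c₂
  · apply hsmall
    refine card_le_of_hom_trivial_ker K ((MonoidHom.snd _ _).comp Λ) fun e h1 => viol e ?_
    have hβ : ((Λ e).2 : ZMod p) = 1 := by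
      rw [show (Λ e).2 = ((MonoidHom.snd _ _).comp Λ) e from rfl, h1, Units.val_one]
    rw [← hΛ2, hβ, h12]; ring
  by_cases h23 : c₂ = c₃
  · apply hsmall
    refine card_le_of_hom_trivial_ker K
      ((MonoidHom.fst _ _).comp Λ * ((MonoidHom.snd _ _).comp Λ)⁻¹) fun e h1 => viol e ?_
    have hαβ : ((Λ e).1 : ZMod p) = ((Λ e).2 : ZMod p) := by
      have : (Λ e).1 * ((Λ e).2)⁻¹ = 1 := h1
      rw [mul_inv_eq_one] at this
      rw [this]
    rw [← hΛ1, ← hΛ2, hαβ, h23]; ring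
  by_cases h13 : c₁ = c₃
  · apply hsmall
    refine card_le_of_hom_trivial_ker K ((MonoidHom.fst _ _).comp Λ) fun e h1 => viol e ?_
    have hα : ((Λ e).1 : ZMod p) = 1 := by
      rw [show (Λ e).1 = ((MonoidHom.fst _ _).comp Λ) e from rfl, h1, Units.val_one]
    rw [← hΛ1, hα, h13]; ring
  -- generic constants: the line `α + s = (s+1)β` with `s = (c₃-c₂)/(c₂-c₁)`
  have ha : c₂ - c₁ ≠ 0 := sub_ne_zero.mpr (Ne.symm h12)
  set s : ZMod p := (c₃ - c₂) / (c₂ - c₁) with hs_def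
  have hs : s ≠ 0 := div_ne_zero (sub_ne_zero.mpr (Ne.symm h23)) ha
  have hs1 : s + 1 ≠ 0 := by
    rw [hs_def, div_add_one ha]
    exact div_ne_zero (by rw [sub_add_sub_cancel]; exact sub_ne_zero.mpr (Ne.symm h13)) ha
  have hinj : Function.Injective Λ := by
    refine (injective_iff_map_eq_one Λ).mpr fun e h1 => viol e ?_
    have hα : ((Λ e).1 : ZMod p) = 1 := by rw [h1, Prod.fst_one, Units.val_one]
    have hβ : ((Λ e).2 : ZMod p) = 1 := by rw [h1, Prod.snd_one, Units.val_one]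
    rw [← hΛ1, ← hΛ2, hα, hβ]; ring
  have hcardΓ : Nat.card Λ.range = Nat.card K := by
    rw [MonoidHom.range_eq_map, Subgroup.card_map_of_injective hinj, Subgroup.card_top]
  have huniq : ∀ g : Λ.range,
      (s + 1) * ((((g : (ZMod p)ˣ × (ZMod p)ˣ).2 : (ZMod p)ˣ) : ZMod p))
        = (((g : (ZMod p)ˣ × (ZMod p)ˣ).1 : (ZMod p)ˣ) : ZMod p) + s → g = 1 := by
    intro g hline
    obtain ⟨e, he⟩ := MonoidHom.mem_range.mp g.2
    have he1 : e = 1 := by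
      refine viol e ?_
      rw [← hΛ1, ← hΛ2, he]
      rw [hs_def] at hline
      field_simp at hline
      linear_combination -hline
    apply Subtype.ext
    rw [← he, he1, map_one, OneMemClass.coe_one]
  have hΓ := card_le_of_line_trivial Λ.range s hs hs1 huniq
  rw [hcardΓ] at hΓ
  exact hΓ

/-- **Weil ceiling, unipotent-free case.** `|H₁||H₂||H₃| ≤ (p-1)³(2 + √p)`. -/
theorem volume_le_sqrt_of_noUnipotent {H₁ H₂ H₃ : Subgroup (GLm p 2)}
    (hH₁ : ∀ h ∈ H₁, (h : Mat p 2) 1 0 = 0) (hH₂ : ∀ h ∈ H₂, (h : Mat p 2) 1 0 = 0)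
    (hH₃ : ∀ h ∈ H₃, (h : Mat p 2) 1 0 = 0)
    (hA₁ : ∀ h ∈ H₁, (h : Mat p 2) 0 0 = 1 → (h : Mat p 2) 1 1 = 1 → h = 1)
    (hA₂ : ∀ h ∈ H₂, (h : Mat p 2) 0 0 = 1 → (h : Mat p 2) 1 1 = 1 → h = 1)
    (hA₃ : ∀ h ∈ H₃, (h : Mat p 2) 0 0 = 1 → (h : Mat p 2) 1 1 = 1 → h = 1)
    (htpp : SubgroupTPP H₁ H₂ H₃) :
    ((Nat.card H₁ * Nat.card H₂ * Nat.card H₃ : ℕ) : ℝ)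
      ≤ ((p : ℝ) - 1) ^ 3 * (2 + Real.sqrt p) := by
  set Φ := tripleDiag hH₁ hH₂ hH₃ with hΦ
  have hdecomp : Nat.card H₁ * Nat.card H₂ * Nat.card H₃ = Nat.card Φ.ker * Nat.card Φ.range := by
    rw [← Subgroup.index_ker, Subgroup.card_mul_index, Nat.card_prod, Nat.card_prod, mul_assoc]
  have hrange : Nat.card Φ.range ≤ (p - 1) ^ 2 := by
    calc Nat.card Φ.range ≤ Nat.card ((ZMod p)ˣ × (ZMod p)ˣ) := Subgroup.card_le_card_group _
      _ = (p - 1) ^ 2 := by rw [Nat.card_prod, natCard_units, sq]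
  have hker := card_ker_le hH₁ hH₂ hH₃ hA₁ hA₂ hA₃ htpp
  have hp1 : (0 : ℝ) ≤ (p : ℝ) - 1 := sub_nonneg.mpr (by exact_mod_cast hp.out.one_lt.le)
  have hrange' : (Nat.card Φ.range : ℝ) ≤ ((p : ℝ) - 1) ^ 2 := by
    have h' : (Nat.card Φ.range : ℝ) ≤ (((p - 1) ^ 2 : ℕ) : ℝ) := by exact_mod_cast hrange
    rw [Nat.cast_pow, Nat.cast_sub hp.out.one_le, Nat.cast_one] at h'
    exact h'
  rw [hdecomp, Nat.cast_mul]
  calc (Nat.card Φ.ker : ℝ) * Nat.card Φ.range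
      ≤ (((p : ℝ) - 1) * (2 + Real.sqrt p)) * ((p : ℝ) - 1) ^ 2 :=
        mul_le_mul hker hrange' (Nat.cast_nonneg _)
          (mul_nonneg hp1 (by positivity))
    _ = ((p : ℝ) - 1) ^ 3 * (2 + Real.sqrt p) := by ring

/-- **Weil ceiling for ALL Borel TPP triples** (`p ≥ 3`): `|H₁||H₂||H₃| ≤ (p-1)³(2 + √p)`.  With
`d = |H₁||H₂||H₃|/(p-1)³ ≤ 2 + √p`, the exponent threshold `ε₀ ≈ 3 ln(p-1)/ln d - 2` of any
Borel instance of the template is `≥ 4 - o(1)`. -/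
theorem borel_tpp_volume_le_sqrt {H₁ H₂ H₃ : Subgroup (GLm p 2)}
    (hH₁ : ∀ h ∈ H₁, (h : Mat p 2) 1 0 = 0) (hH₂ : ∀ h ∈ H₂, (h : Mat p 2) 1 0 = 0)
    (hH₃ : ∀ h ∈ H₃, (h : Mat p 2) 1 0 = 0) (htpp : SubgroupTPP H₁ H₂ H₃) :
    ((Nat.card H₁ * Nat.card H₂ * Nat.card H₃ : ℕ) : ℝ)
      ≤ ((p : ℝ) - 1) ^ 3 * (2 + Real.sqrt p) := by
  have hp2 := hp.out.two_le
  have hp1 : (1 : ℝ) ≤ (p : ℝ) - 1 := le_sub_iff_add_le.mpr (by norm_num; exact_mod_cast hp2)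
  -- the unipotent case: `p(p-1)² ≤ (p-1)³(2+√p)`
  have hunip : ((p * (p - 1) ^ 2 : ℕ) : ℝ) ≤ ((p : ℝ) - 1) ^ 3 * (2 + Real.sqrt p) := by
    rw [Nat.cast_mul, Nat.cast_pow, Nat.cast_sub hp.out.one_le, Nat.cast_one]
    have hs := Real.sqrt_nonneg (p : ℝ)
    have key : ((p : ℝ) - 1) ^ 3 * (2 + Real.sqrt p) - (p : ℝ) * ((p : ℝ) - 1) ^ 2
        = ((p : ℝ) - 1) ^ 2 * (((p : ℝ) - 1) * (1 + Real.sqrt p) - 1) := by ring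
    have h2 : (0 : ℝ) ≤ ((p : ℝ) - 1) * (1 + Real.sqrt p) - 1 := by nlinarith [hs, hp1]
    nlinarith [key, mul_nonneg (sq_nonneg ((p : ℝ) - 1)) h2]
  have aux : ∀ n : ℕ, n ≤ p * (p - 1) ^ 2 → (n : ℝ) ≤ ((p : ℝ) - 1) ^ 3 * (2 + Real.sqrt p) :=
    fun n hn => (Nat.cast_le.mpr hn).trans hunip
  by_cases hA₁ : ∀ h ∈ H₁, (h : Mat p 2) 0 0 = 1 → (h : Mat p 2) 1 1 = 1 → h = 1
  · by_cases hA₂ : ∀ h ∈ H₂, (h : Mat p 2) 0 0 = 1 → (h : Mat p 2) 1 1 = 1 → h = 1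
    · by_cases hA₃ : ∀ h ∈ H₃, (h : Mat p 2) 0 0 = 1 → (h : Mat p 2) 1 1 = 1 → h = 1
      · exact volume_le_sqrt_of_noUnipotent hH₁ hH₂ hH₃ hA₁ hA₂ hA₃ htpp
      · push Not at hA₃
        obtain ⟨g, hg, h00, h11, hg1⟩ := hA₃
        have := volume_le_of_unipotent hH₃ hH₁ hH₂ ⟨g, hg, h00, h11, hg1⟩ htpp.rotate.rotate
        refine aux _ ?_
        calc Nat.card H₁ * Nat.card H₂ * Nat.card H₃
            = Nat.card H₃ * Nat.card H₁ * Nat.card H₂ := by ring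
          _ ≤ p * (p - 1) ^ 2 := this
    · push Not at hA₂
      obtain ⟨g, hg, h00, h11, hg1⟩ := hA₂
      have := volume_le_of_unipotent hH₂ hH₃ hH₁ ⟨g, hg, h00, h11, hg1⟩ htpp.rotate
      refine aux _ ?_
      calc Nat.card H₁ * Nat.card H₂ * Nat.card H₃
          = Nat.card H₂ * Nat.card H₃ * Nat.card H₁ := by ring
        _ ≤ p * (p - 1) ^ 2 := this
  · push Not at hA₁
    obtain ⟨g, hg, h00, h11, hg1⟩ := hA₁
    exact aux _ (volume_le_of_unipotent hH₁ hH₂ hH₃ ⟨g, hg, h00, h11, hg1⟩ htpp)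

end ToralCeiling

end Summit.MatrixMultiplication.MatrixMultiplication.Theorems.SubgroupIdentityDesigns.Negative
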